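import Literature.Topology.FourManifolds.FlowsBoundaryInvariant
import Literature.Topology.FourManifolds.BoundaryTangentLift
import Literature.Geometry.Manifold.TranslationFlowLocal
import Literature.Geometry.Manifold.ProperSubmersionTrivial
import HarnessLib

/-!
# Ehresmann's theorem with boundary: product structure over a box of regular values

Topic `Literature/Topology/FourManifolds` (fact seat
`provefact-Literature.Geometry.Symplectic.Oba2016_s-add47373d4`: the product structure
`f⁻¹(Q) ≅ Q × F` of a Lefschetz fibration with bounded fibres over a box `Q` of regular values,
horizontal boundary included — Kas 1980 / Gompf–Stipsicz 1999 §8.2, the `F × D²` part of the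
handlebody of a Lefschetz fibration over the disc).  Everything is proved; no definitions.

Bröcker–Jänich, *Introduction to Differential Topology* (1982), (8.12) and its proof (PDF
pp. 57–58): lift the basic fields, flow, and fold — *"`φ(u, x) = Φ¹_{u_1} ∘ … ∘ Φⁿ_{u_n}(x)` …
`φ⁻¹(y) = (u, Φⁿ_{-u_n} ∘ … ∘ Φ¹_{-u_1}(y))`"*; the tree has this for proper submersions of
manifolds WITHOUT boundary onto `ℝᵐ` (`Literature.Geometry.Manifold.exists_homeomorph_fibre_prod_of_surjective_mfderiv`,
`ProperSubmersionTrivial.lean`).  Here the version for a **compact manifold with boundary**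
`M` (model `𝓡∂ (k + 1)`) and a smooth `g : M → ℝᵐ` over a box
`K̂ = {u | |u i - c₀ i| ≤ Δ}` of the base on whose preimage `dg` is onto at interior points and
onto already on the boundary tangent hyperplane at boundary points (the base values are regular
for `g` AND for `g|∂M` — Ehresmann's theorem for manifolds with boundary, e.g. the horizontal
boundary of a Lefschetz fibration over the disc):

* §0 `mfderiv_apply_zero_of_forall_mem_boundary` — the differential of a map into `∂M` is
  tangent to `∂M`; `exists_apply_zero_eq_zero_and_mfderiv_eq` — the boundary hypothesis below
  from "`g ∘ f` is a submersion" for a map `f` onto the boundary;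
* §1 the lifted fields are tangent to `∂M` (`Literature.Topology.FourManifolds.exists_contMDiff_lift_tangent`), their
  global flows exist (`Literature.Topology.FourManifolds.exists_isSmoothFlow_of_tangent`), preserve `∂M` and `Int M`
  (`Literature.Topology.FourManifolds.IsSmoothFlow.mem_boundary_iff_of_tangent`) and translate `g` as long as the
  translate stays in the open box (`Literature.Geometry.Manifold.apply_integralCurve_eq_add_smul_of_segment`):
  `exists_isSmoothFlow_translating`;
* §2 folds of such flows: coordinates of `g` along a fold (`apply_foldr_translating_coord`),
  smoothness (`contMDiff_foldr_flow`), boundary behaviour (`foldr_flow_mem_boundary_iff`);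
* §3 **the product structure** `exists_trivialisation_of_box`: smooth `Φ : ℝᵐ × M → M` and
  `Ψ : M → M` with `g (Φ (u, y)) = u`, `Ψ (Φ (u, y)) = y` for `g y = c₀` and `u` in the open
  box of half-width `δ ≤ Δ`, `g (Ψ x) = c₀`, `Φ (g x, Ψ x) = x` for `g x` in that box,
  `Φ (c₀, y) = y`, and `Φ (u, y) ∈ ∂M ↔ y ∈ ∂M`, `Ψ x ∈ ∂M ↔ x ∈ ∂M` — i.e. `(u, y) ↦ Φ (u, y)`
  is a bijection from `Q_δ × g⁻¹(c₀)` onto `g⁻¹(Q_δ)` over `Q_δ`, smooth in the ambient sense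
  together with its inverse `x ↦ (g x, Ψ x)`, carrying `Q_δ × (g⁻¹(c₀) ∩ ∂M)` onto
  `g⁻¹(Q_δ) ∩ ∂M`.

## References

* Th. Bröcker, K. Jänich, *Introduction to Differential Topology*, CUP 1982, (8.12) and its
  proof (PDF pp. 57–58). [BrockerJanichIDT1982]
* J. M. Lee, *Introduction to Smooth Manifolds*, 2nd ed., GTM 218 (2012), Thm. 9.34.
  [LeeSmoothManifolds2013]
* R. E. Gompf, A. I. Stipsicz, *4-Manifolds and Kirby Calculus*, GSM 20 (1999), §8.2 (the
  handlebody of a Lefschetz fibration over `D²`). [GompfStipsiczGSM1999]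
-/

open scoped Manifold ContDiff Topology
open Set Function Filter

noncomputable section

namespace Literature.Topology.FourManifolds

universe u

variable {k m : ℕ} {M : Type u} [TopologicalSpace M] [ChartedSpace (EuclideanHalfSpace (k + 1)) M]
  [IsManifold (𝓡∂ (k + 1)) ∞ M]

/-! ### Boxes in `ℝᵐ` -/

omit [IsManifold (𝓡∂ (k + 1)) ∞ M] in
/-- The open box `{w | ∀ i, |w i - c₀ i| < r}` is open. [folklore] -/
theorem isOpen_setOf_forall_abs_sub_lt (c₀ : EuclideanSpace ℝ (Fin m)) (r : ℝ) :
    IsOpen {w : EuclideanSpace ℝ (Fin m) | ∀ i, |w i - c₀ i| < r} := by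
  rw [setOf_forall]
  exact isOpen_iInter_of_finite fun i =>
    isOpen_lt (continuous_abs.comp (((EuclideanSpace.proj i).continuous).sub continuous_const))
      continuous_const

omit [ChartedSpace (EuclideanHalfSpace (k + 1)) M] [IsManifold (𝓡∂ (k + 1)) ∞ M] in
/-- The preimage of the closed box `{w | ∀ i, |w i - c₀ i| ≤ r}` under a continuous map is
closed. [folklore] -/
theorem isClosed_setOf_forall_abs_apply_sub_le {g : M → EuclideanSpace ℝ (Fin m)}
    (hg : Continuous g) (c₀ : EuclideanSpace ℝ (Fin m)) (r : ℝ) :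
    IsClosed {x : M | ∀ i, |g x i - c₀ i| ≤ r} := by
  rw [setOf_forall]
  exact isClosed_iInter fun i =>
    isClosed_le (continuous_abs.comp ((((EuclideanSpace.proj i).continuous).comp hg).sub
      continuous_const)) continuous_const

omit [IsManifold (𝓡∂ (k + 1)) ∞ M] in
/-- Moving one coordinate of a point of the open box towards another value in the box keeps the
point in the (larger) open box: the segment condition of the translation lemma. [folklore] -/
theorem add_smul_single_mem_box {c₀ w : EuclideanSpace ℝ (Fin m)} {δ Δ : ℝ} (hδΔ : δ ≤ Δ)
    (hw : ∀ j, |w j - c₀ j| < δ) (i : Fin m) {a : ℝ} (ha : |a - c₀ i| < δ) {s : ℝ}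
    (hs : s ∈ uIcc 0 (a - w i)) :
    ∀ j, |(w + s • EuclideanSpace.single i (1 : ℝ)) j - c₀ j| < Δ := by
  intro j
  rw [PiLp.add_apply, PiLp.smul_apply, PiLp.single_apply, smul_eq_mul]
  by_cases hj : j = i
  · subst hj
    rw [if_pos rfl, mul_one]
    have h1 := hw j
    rw [abs_lt] at h1 ha ⊢
    rcases le_total 0 (a - w j) with h | h
    · rw [uIcc_of_le h] at hs
      constructor <;> linarith [hs.1, hs.2]
    · rw [uIcc_of_ge h] at hs
      constructor <;> linarith [hs.1, hs.2]
  · rw [if_neg hj, mul_zero, add_zero]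
    exact lt_of_lt_of_le (hw j) hδΔ

/-! ### Maps into the boundary: the differential is tangent to the boundary -/

section IntoBoundary

variable {EN : Type*} [NormedAddCommGroup EN] [NormedSpace ℝ EN] {HN : Type*} [TopologicalSpace HN]
  {IN : ModelWithCorners ℝ EN HN} {N : Type*} [TopologicalSpace N] [ChartedSpace HN N]

/-- **The differential of a map into the boundary is tangent to the boundary** (Lee 2012,
Prop. 5.41: vectors tangent to `∂M` are those with vanishing normal coordinate): if
`f : N → M` takes values in `∂M`, then `(df_y u) 0 = 0` (`halfSpaceCoord k (df_y u) = 0`)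
for every `u ∈ T_yN` — the coordinate `0`
of `f` read in the charts at `y` and `f y` vanishes identically near `y`
(`Literature.Topology.FourManifolds.extChartAt_apply_zero_of_mem_boundary`), so its derivative vanishes; if `f` is not
differentiable at `y`, `df_y = 0` by convention.  (The tree's
`Literature.Topology.FourManifolds.normalCoord_mfderiv_eq_zero`, `PontryaginNumberBordismInvariance.lean`, is the same
statement through the functional `normalCoord`; restated here on the coordinate to keep the
imports of this file light.) [cite: LeeSmoothManifolds2013, Prop. 5.41] -/
theorem mfderiv_apply_zero_of_forall_mem_boundary {f : N → M}
    (hf : ∀ x, f x ∈ (𝓡∂ (k + 1)).boundary M) (y : N) (u : TangentSpace IN y) :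
    halfSpaceCoord k (mfderiv IN (𝓡∂ (k + 1)) f y u) = 0 := by
  by_cases hd : MDifferentiableAt IN (𝓡∂ (k + 1)) f y
  · set q₀ : EN := extChartAt IN y y with hq₀
    have hD : HasFDerivWithinAt (writtenInExtChartAt IN (𝓡∂ (k + 1)) y f)
        (mfderiv IN (𝓡∂ (k + 1)) f y) (range IN) q₀ := hd.hasMFDerivAt.2
    -- the coordinate `0` of `f` read in the charts, and its derivative
    have hg' : HasFDerivWithinAt (fun q => halfSpaceCoord k (writtenInExtChartAt IN (𝓡∂ (k + 1)) y f q))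
        ((halfSpaceCoord k).comp (mfderiv IN (𝓡∂ (k + 1)) f y)) (range IN) q₀ :=
      (halfSpaceCoord k).hasFDerivAt.comp_hasFDerivWithinAt q₀ hD
    -- it vanishes near `q₀` within `range IN`
    have hzero : (fun q => halfSpaceCoord k (writtenInExtChartAt IN (𝓡∂ (k + 1)) y f q))
        =ᶠ[𝓝[range IN] q₀] fun _ => 0 := by
      have h1 : (extChartAt IN y).target ∈ 𝓝[range IN] q₀ := extChartAt_target_mem_nhdsWithin y
      have hcont : ContinuousAt (f ∘ (extChartAt IN y).symm) q₀ := by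
        refine ContinuousAt.comp ?_ (continuousAt_extChartAt_symm y)
        rw [extChartAt_to_inv]; exact hd.continuousAt
      have h2 : ∀ᶠ q in 𝓝 q₀, f ((extChartAt IN y).symm q) ∈
          (extChartAt (𝓡∂ (k + 1)) (f y)).source := by
        refine hcont.preimage_mem_nhds ?_
        show (extChartAt (𝓡∂ (k + 1)) (f y)).source ∈ 𝓝 ((f ∘ (extChartAt IN y).symm) q₀)
        rw [comp_apply, hq₀, extChartAt_to_inv]
        exact extChartAt_source_mem_nhds (f y)
      filter_upwards [h1, mem_nhdsWithin_of_mem_nhds h2] with q _ hq2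
      rw [halfSpaceCoord_apply]
      exact extChartAt_apply_zero_of_mem_boundary hq2 (hf _)
    have hq₀0 : halfSpaceCoord k (writtenInExtChartAt IN (𝓡∂ (k + 1)) y f q₀) = 0 := by
      rw [halfSpaceCoord_apply, hq₀]
      refine extChartAt_apply_zero_of_mem_boundary ?_ ?_
      · simp only [comp_apply, extChartAt_to_inv]
        exact mem_extChartAt_source (f y)
      · simp only [comp_apply, extChartAt_to_inv]
        exact hf y
    have hg0 : HasFDerivWithinAt (fun q => halfSpaceCoord k (writtenInExtChartAt IN (𝓡∂ (k + 1)) y f q))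
        (0 : EN →L[ℝ] ℝ) (range IN) q₀ :=
      (hasFDerivWithinAt_const (0 : ℝ) q₀ (range IN)).congr_of_eventuallyEq hzero hq₀0
    have huniq : UniqueDiffWithinAt ℝ (range IN) q₀ :=
      IN.uniqueDiffOn _ (extChartAt_target_subset_range y (mem_extChartAt_target y))
    have heq := huniq.eq hg' hg0
    exact DFunLike.congr_fun heq u
  · rw [mfderiv_zero_of_not_mdifferentiableAt hd]
    exact map_zero (halfSpaceCoord k)

/-- **Regular values of `g|∂M` give boundary-tangent preimages**: if `f : N → M` lands in
`∂M`, is differentiable at `y`, and `g ∘ f` has onto differential at `y`, then every `w` has a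
preimage under `dg_{f y}` in the boundary tangent hyperplane `{v | v 0 = 0}` (namely `df_y u`
for a preimage `u` under `d(g ∘ f)_y`) — the hypothesis `hbdry` of `exists_trivialisation_of_box`
from "`g|∂M` is a submersion" (e.g. the horizontal boundary of a Lefschetz fibration over the
disc). [cite: LeeSmoothManifolds2013, Prop. 5.41] -/
theorem exists_apply_zero_eq_zero_and_mfderiv_eq {F : Type*} [NormedAddCommGroup F]
    [NormedSpace ℝ F] {f : N → M} (hf : ∀ x, f x ∈ (𝓡∂ (k + 1)).boundary M) {g : M → F}
    {y : N} (hg : MDifferentiableAt (𝓡∂ (k + 1)) 𝓘(ℝ, F) g (f y))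
    (hfd : MDifferentiableAt IN (𝓡∂ (k + 1)) f y)
    (hs : Surjective (mfderiv IN 𝓘(ℝ, F) (g ∘ f) y)) (w : F) :
    ∃ v : EuclideanSpace ℝ (Fin (k + 1)), v 0 = 0 ∧ mfderiv (𝓡∂ (k + 1)) 𝓘(ℝ, F) g (f y) v = w := by
  obtain ⟨u, hu⟩ := hs w
  refine ⟨mfderiv IN (𝓡∂ (k + 1)) f y u, ?_, ?_⟩
  · have h := mfderiv_apply_zero_of_forall_mem_boundary hf y u
    rwa [halfSpaceCoord_apply] at h
  · rw [mfderiv_comp y hg hfd] at hu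
    exact hu

end IntoBoundary

/-! ### §1 Translating flows of boundary-tangent lifts -/

variable [T2Space M] [CompactSpace M]

/-- **Translating flows with boundary.**  Let `M` be a compact Hausdorff manifold with boundary,
`g : M → ℝᵐ` smooth, `c₀ ∈ ℝᵐ`, `Δ > 0`, and assume that on the preimage of the closed box
`K̂ = {u | ∀ i, |u i - c₀ i| ≤ Δ}` the differential `dg_x` is onto at interior points and onto
on the boundary tangent hyperplane `{v | v 0 = 0}` at boundary points.  Then for each basic
vector `eᵢ` there is a smooth global flow `θ` of a smooth vector field tangent to `∂M`
(`Literature.Topology.FourManifolds.IsSmoothFlow`), preserving `∂M`, which **translates `g` by `t eᵢ`** whenever the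
segment `g p + [0, t] eᵢ` stays in the open box of half-width `Δ`. [cite: BrockerJanichIDT1982, (8.12) (proof)]
[cite: LeeSmoothManifolds2013, Thm. 9.34] -/
theorem exists_isSmoothFlow_translating {g : M → EuclideanSpace ℝ (Fin m)}
    (hg : ContMDiff (𝓡∂ (k + 1)) 𝓘(ℝ, EuclideanSpace ℝ (Fin m)) ∞ g)
    {c₀ : EuclideanSpace ℝ (Fin m)} {Δ : ℝ}
    (hint : ∀ x, (∀ i, |g x i - c₀ i| ≤ Δ) → (𝓡∂ (k + 1)).IsInteriorPoint x →
      Surjective (mfderiv (𝓡∂ (k + 1)) 𝓘(ℝ, EuclideanSpace ℝ (Fin m)) g x))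
    (hbdry : ∀ x, (∀ i, |g x i - c₀ i| ≤ Δ) → x ∈ (𝓡∂ (k + 1)).boundary M →
      ∀ w : EuclideanSpace ℝ (Fin m), ∃ v : EuclideanSpace ℝ (Fin (k + 1)), v 0 = 0 ∧
        mfderiv (𝓡∂ (k + 1)) 𝓘(ℝ, EuclideanSpace ℝ (Fin m)) g x v = w)
    (i : Fin m) :
    ∃ (X : Π x : M, TangentSpace (𝓡∂ (k + 1)) x) (θ : ℝ × M → M),
      ContMDiff (𝓡∂ (k + 1)) (𝓡∂ (k + 1)).tangent ∞
        (fun x => (⟨x, X x⟩ : TangentBundle (𝓡∂ (k + 1)) M)) ∧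
      (∀ z ∈ (𝓡∂ (k + 1)).boundary M, halfSpaceCoord k (X z) = 0) ∧
      IsSmoothFlow (𝓡∂ (k + 1)) X θ ∧
      (∀ t p, θ (t, p) ∈ (𝓡∂ (k + 1)).boundary M ↔ p ∈ (𝓡∂ (k + 1)).boundary M) ∧
      ∀ (p : M) (t : ℝ), (∀ s ∈ uIcc 0 t, ∀ j, |(g p + s • EuclideanSpace.single i (1 : ℝ)) j - c₀ j| < Δ) →
        g (θ (t, p)) = g p + t • EuclideanSpace.single i (1 : ℝ) := by
  set C : Set M := {x | ∀ i, |g x i - c₀ i| ≤ Δ} with hC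
  have hCc : IsClosed C := isClosed_setOf_forall_abs_apply_sub_le hg.continuous c₀ Δ
  obtain ⟨X, hXs, hXt, hXc⟩ := exists_contMDiff_lift_tangent hg hCc
    (fun x hx hxi => hint x hx hxi) (fun x hx hxb => hbdry x hx hxb) (EuclideanSpace.single i (1 : ℝ))
  obtain ⟨θ, hθ, -⟩ := exists_isSmoothFlow_of_tangent hXs hXt
  refine ⟨X, θ, hXs, hXt, hθ, fun t p => hθ.mem_boundary_iff_of_tangent hXs hXt t p,
    fun p t hseg => ?_⟩
  set Q : Set (EuclideanSpace ℝ (Fin m)) := {w | ∀ j, |w j - c₀ j| < Δ} with hQ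
  have hQo : IsOpen Q := isOpen_setOf_forall_abs_sub_lt c₀ Δ
  have hQC : g ⁻¹' Q ⊆ C := fun x hx j => (hx j).le
  have hγ : IsMIntegralCurve (fun t => θ (t, p)) X := hθ.isMIntegralCurve p
  have h0 : θ (0, p) = p := hθ.map_zero p
  have hseg' : ∀ s ∈ uIcc 0 t, g (θ (0, p)) + s • EuclideanSpace.single i (1 : ℝ) ∈ Q := by
    intro s hs
    rw [h0]
    exact hseg s hs
  have h := Literature.Geometry.Manifold.apply_integralCurve_eq_add_smul_of_segment
    (hg.of_le (by norm_cast)) hXc hQo hQC hγ hseg' (s := t) right_mem_uIcc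
  rw [h0] at h
  exact h

/-! ### §2 Folds of translating flows -/

section Folds

variable {g : M → EuclideanSpace ℝ (Fin m)} {c₀ : EuclideanSpace ℝ (Fin m)} {δ Δ : ℝ}
  {θ : Fin m → ℝ × M → M}

omit [TopologicalSpace M] [ChartedSpace (EuclideanHalfSpace (k + 1)) M] [IsManifold (𝓡∂ (k + 1)) ∞ M]
  [T2Space M] [CompactSpace M] in
/-- **Coordinates of `g` along a fold of translating flows.**  If each `θ i` translates `g` by
`t eᵢ` as long as the segment stays in the open `Δ`-box, then for a duplicate-free list `l` of
coordinates, target values `u` and a start point `y` with `g y = v`, `u` and `v` in the open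
`δ`-box (`δ ≤ Δ`), the fold `θ_{i₁}(u_{i₁} - v_{i₁}, θ_{i₂}(…, y)…)` has `g`-coordinate `u j`
for `j ∈ l` and `v j` otherwise (Bröcker–Jänich 1982, proof of (8.12): "`u = pr₁(u, x) =
f ∘ φ(u, x)`"). [cite: BrockerJanichIDT1982, (8.12) (proof)] -/
theorem apply_foldr_translating_coord (hδΔ : δ ≤ Δ)
    (hθ : ∀ (i : Fin m) (p : M) (t : ℝ),
      (∀ s ∈ uIcc 0 t, ∀ j, |(g p + s • EuclideanSpace.single i (1 : ℝ)) j - c₀ j| < Δ) →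
        g (θ i (t, p)) = g p + t • EuclideanSpace.single i (1 : ℝ))
    {u v : EuclideanSpace ℝ (Fin m)} (hu : ∀ j, |u j - c₀ j| < δ) (hv : ∀ j, |v j - c₀ j| < δ)
    (l : List (Fin m)) (hl : l.Nodup) {y : M} (hy : g y = v) (j : Fin m) :
    g (l.foldr (fun i acc => θ i (u i - v i, acc)) y) j = if j ∈ l then u j else v j := by
  induction l generalizing j with
  | nil => simp [hy]
  | cons i l ih =>
    have hil : i ∉ l := (List.nodup_cons.1 hl).1
    have hl' : l.Nodup := (List.nodup_cons.1 hl).2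
    set z := l.foldr (fun i acc => θ i (u i - v i, acc)) y with hz
    have hzc : ∀ j, g z j = if j ∈ l then u j else v j := fun j => ih hl' j
    have hzbox : ∀ j, |g z j - c₀ j| < δ := fun j => by
      rw [hzc j]; split_ifs
      · exact hu j
      · exact hv j
    have hzi : g z i = v i := by rw [hzc i, if_neg hil]
    have hseg : ∀ s ∈ uIcc 0 (u i - v i), ∀ j,
        |(g z + s • EuclideanSpace.single i (1 : ℝ)) j - c₀ j| < Δ := fun s hs =>
      add_smul_single_mem_box hδΔ hzbox i (hu i) (by rw [hzi]; exact hs)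
    rw [List.foldr_cons, hθ i z (u i - v i) hseg, PiLp.add_apply, PiLp.smul_apply,
      PiLp.single_apply, smul_eq_mul, hzc j]
    by_cases hji : j = i
    · subst hji
      rw [if_neg hil, if_pos rfl, mul_one, if_pos List.mem_cons_self]
      ring
    · rw [if_neg hji, mul_zero, add_zero]
      by_cases hjl : j ∈ l
      · rw [if_pos hjl, if_pos (List.mem_cons_of_mem i hjl)]
      · rw [if_neg hjl, if_neg (by simp [hji, hjl])]

omit [TopologicalSpace M] [ChartedSpace (EuclideanHalfSpace (k + 1)) M] [IsManifold (𝓡∂ (k + 1)) ∞ M]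
  [T2Space M] [CompactSpace M] in
/-- A fold of flows with all times zero is the identity. [folklore] -/
theorem foldr_flow_zero (h0 : ∀ i p, θ i (0, p) = p) (l : List (Fin m)) (y : M) :
    l.foldr (fun i acc => θ i (0, acc)) y = y := by
  induction l with
  | nil => rfl
  | cons i l ih => rw [List.foldr_cons, ih, h0]

omit [IsManifold (𝓡∂ (k + 1)) ∞ M] [T2Space M] [CompactSpace M] in
/-- A fold of boundary-preserving maps preserves the boundary (iff). [folklore] -/
theorem foldr_flow_mem_boundary_iff
    (hb : ∀ i t p, θ i (t, p) ∈ (𝓡∂ (k + 1)).boundary M ↔ p ∈ (𝓡∂ (k + 1)).boundary M)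
    (a : Fin m → ℝ) (l : List (Fin m)) (y : M) :
    l.foldr (fun i acc => θ i (a i, acc)) y ∈ (𝓡∂ (k + 1)).boundary M ↔
      y ∈ (𝓡∂ (k + 1)).boundary M := by
  induction l with
  | nil => exact Iff.rfl
  | cons i l ih => rw [List.foldr_cons, hb, ih]

omit [IsManifold (𝓡∂ (k + 1)) ∞ M] [T2Space M] [CompactSpace M] in
/-- **Folds of smooth flows with smoothly varying times are smooth**, jointly in the parameter
and the point. [folklore] -/
theorem contMDiff_foldr_flow {P : Type*} [TopologicalSpace P] {EP : Type*} [NormedAddCommGroup EP]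
    [NormedSpace ℝ EP] {HP : Type*} [TopologicalSpace HP] {IP : ModelWithCorners ℝ EP HP}
    [ChartedSpace HP P]
    (hθ : ∀ i, ContMDiff (𝓘(ℝ, ℝ).prod (𝓡∂ (k + 1))) (𝓡∂ (k + 1)) ∞ (θ i))
    {a : Fin m → P → ℝ} (ha : ∀ i, ContMDiff IP 𝓘(ℝ, ℝ) ∞ (a i)) (l : List (Fin m)) :
    ContMDiff (IP.prod (𝓡∂ (k + 1))) (𝓡∂ (k + 1)) ∞
      fun q : P × M => l.foldr (fun i acc => θ i (a i q.1, acc)) q.2 := by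
  induction l with
  | nil => simpa using contMDiff_snd
  | cons i l ih =>
    simp only [List.foldr_cons]
    exact (hθ i).comp (((ha i).comp contMDiff_fst).prodMk ih)

end Folds

/-! ### §3 The product structure over a box -/

/-- **Ehresmann's theorem with boundary, over a box** (Bröcker–Jänich 1982, (8.12) and its
proof, for a compact manifold with boundary and base values regular for `g` and for `g|∂M`).
Let `M` be a compact Hausdorff manifold with boundary (model `𝓡∂ (k + 1)`),
`g : M → ℝᵐ` smooth, `c₀ ∈ ℝᵐ`, `0 < δ ≤ Δ`, and suppose that at every `x` with
`|g x i - c₀ i| ≤ Δ` for all `i` the differential `dg_x` is onto if `x` is an interior point,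
and onto on the boundary tangent hyperplane `{v | v 0 = 0}` if `x ∈ ∂M`.  Then there are smooth
maps `Φ : ℝᵐ × M → M` and `Ψ : M → M` such that, with `Q = {u | ∀ i, |u i - c₀ i| < δ}`:
`Φ (c₀, y) = y`; for `g y = c₀` and `u ∈ Q`, `g (Φ (u, y)) = u` and `Ψ (Φ (u, y)) = y`; for
`g x ∈ Q`, `g (Ψ x) = c₀` and `Φ (g x, Ψ x) = x`; and `Φ (u, y) ∈ ∂M ↔ y ∈ ∂M`,
`Ψ x ∈ ∂M ↔ x ∈ ∂M`.  Thus `(u, y) ↦ Φ (u, y)` is a bijection `Q × g⁻¹(c₀) → g⁻¹(Q)` over `Q`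
with inverse `x ↦ (g x, Ψ x)`, both smooth in the ambient sense, respecting the boundary: the
product structure `g⁻¹(Q) ≅ Q × g⁻¹(c₀)`, horizontal boundary `g⁻¹(Q) ∩ ∂M ≅ Q × (g⁻¹(c₀) ∩ ∂M)`
included (`Φ` is the fold `θ₀(u₀ - c₀₀, θ₁(u₁ - c₀₁, …))` of the translating flows of §1, `Ψ`
the reverse fold with the times `c₀ i - g x i`). [cite: BrockerJanichIDT1982, (8.12)]
[cite: LeeSmoothManifolds2013, Thm. 9.34] [cite: GompfStipsiczGSM1999, §8.2] -/
theorem exists_trivialisation_of_box {g : M → EuclideanSpace ℝ (Fin m)}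
    (hg : ContMDiff (𝓡∂ (k + 1)) 𝓘(ℝ, EuclideanSpace ℝ (Fin m)) ∞ g)
    {c₀ : EuclideanSpace ℝ (Fin m)} {δ Δ : ℝ} (hδΔ : δ ≤ Δ)
    (hint : ∀ x, (∀ i, |g x i - c₀ i| ≤ Δ) → (𝓡∂ (k + 1)).IsInteriorPoint x →
      Surjective (mfderiv (𝓡∂ (k + 1)) 𝓘(ℝ, EuclideanSpace ℝ (Fin m)) g x))
    (hbdry : ∀ x, (∀ i, |g x i - c₀ i| ≤ Δ) → x ∈ (𝓡∂ (k + 1)).boundary M →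
      ∀ w : EuclideanSpace ℝ (Fin m), ∃ v : EuclideanSpace ℝ (Fin (k + 1)), v 0 = 0 ∧
        mfderiv (𝓡∂ (k + 1)) 𝓘(ℝ, EuclideanSpace ℝ (Fin m)) g x v = w) :
    ∃ (Φ : EuclideanSpace ℝ (Fin m) × M → M) (Ψ : M → M),
      ContMDiff (𝓘(ℝ, EuclideanSpace ℝ (Fin m)).prod (𝓡∂ (k + 1))) (𝓡∂ (k + 1)) ∞ Φ ∧
      ContMDiff (𝓡∂ (k + 1)) (𝓡∂ (k + 1)) ∞ Ψ ∧
      (∀ y, Φ (c₀, y) = y) ∧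
      (∀ y, g y = c₀ → ∀ u : EuclideanSpace ℝ (Fin m), (∀ i, |u i - c₀ i| < δ) →
        g (Φ (u, y)) = u ∧ Ψ (Φ (u, y)) = y) ∧
      (∀ x, (∀ i, |g x i - c₀ i| < δ) → g (Ψ x) = c₀ ∧ Φ (g x, Ψ x) = x) ∧
      (∀ u y, Φ (u, y) ∈ (𝓡∂ (k + 1)).boundary M ↔ y ∈ (𝓡∂ (k + 1)).boundary M) ∧
      (∀ x, Ψ x ∈ (𝓡∂ (k + 1)).boundary M ↔ x ∈ (𝓡∂ (k + 1)).boundary M) := by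
  -- the translating flows
  choose X θ hXs hXt hθ hθb hθg using exists_isSmoothFlow_translating hg hint hbdry
  have h0 : ∀ i p, θ i (0, p) = p := fun i p => (hθ i).map_zero p
  have hadd : ∀ i t s p, θ i (t, θ i (s, p)) = θ i (t + s, p) := fun i => (hθ i).map_add
  -- the folds
  set Φ : EuclideanSpace ℝ (Fin m) × M → M := fun q =>
    (List.finRange m).foldr (fun i acc => θ i (q.1 i - c₀ i, acc)) q.2 with hΦ
  set Ψ : M → M := fun x =>
    (List.finRange m).foldl (fun acc i => θ i (-(g x i - c₀ i), acc)) x with hΨ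
  have hΨ' : ∀ x, Ψ x = (List.finRange m).reverse.foldr (fun i acc => θ i (c₀ i - g x i, acc)) x := by
    intro x
    simp only [hΨ, List.foldl_eq_foldr_reverse, neg_sub]
  have hδbox : ∀ {w : EuclideanSpace ℝ (Fin m)}, (∀ i, |w i - c₀ i| < δ) → ∀ i, |c₀ i - c₀ i| < δ :=
    fun hw i => by rw [sub_self, abs_zero]; exact lt_of_le_of_lt (abs_nonneg _) (hw i)
  refine ⟨Φ, Ψ, ?_, ?_, fun y => ?_, fun y hy u hu => ?_, fun x hx => ?_, fun u y => ?_, fun x => ?_⟩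
  · -- smoothness of `Φ`
    exact contMDiff_foldr_flow (IP := 𝓘(ℝ, EuclideanSpace ℝ (Fin m))) (fun i => (hθ i).contMDiff)
      (fun i => ((EuclideanSpace.proj i).contMDiff).sub contMDiff_const) (List.finRange m)
  · -- smoothness of `Ψ`: a fold with times depending smoothly on the point
    have h1 : ContMDiff ((𝓡∂ (k + 1)).prod (𝓡∂ (k + 1))) (𝓡∂ (k + 1)) ∞
        fun q : M × M => (List.finRange m).reverse.foldr
          (fun i acc => θ i (c₀ i - g q.1 i, acc)) q.2 :=
      contMDiff_foldr_flow (IP := 𝓡∂ (k + 1)) (fun i => (hθ i).contMDiff)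
        (fun i => contMDiff_const.sub (((EuclideanSpace.proj i).contMDiff).comp hg))
        (List.finRange m).reverse
    have h2 : ContMDiff (𝓡∂ (k + 1)) (𝓡∂ (k + 1)) ∞ fun x =>
        (List.finRange m).reverse.foldr (fun i acc => θ i (c₀ i - g x i, acc)) x :=
      h1.comp (contMDiff_id.prodMk contMDiff_id)
    exact h2.congr fun x => (hΨ' x)
  · -- `Φ (c₀, y) = y`
    show (List.finRange m).foldr (fun i acc => θ i (c₀ i - c₀ i, acc)) y = y
    simp only [sub_self]
    exact foldr_flow_zero h0 _ y
  · -- over the fibre of `c₀`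
    have hgΦ : g (Φ (u, y)) = u := by
      ext j
      have h := apply_foldr_translating_coord hδΔ hθg hu (hδbox hu) (List.finRange m)
        (List.nodup_finRange m) hy j
      rw [if_pos (List.mem_finRange j)] at h
      exact h
    refine ⟨hgΦ, ?_⟩
    show (List.finRange m).foldl (fun acc i => θ i (-(g (Φ (u, y)) i - c₀ i), acc)) (Φ (u, y)) = y
    rw [hgΦ]
    exact Literature.Geometry.Manifold.foldl_foldr_flow h0 hadd (fun i => u i - c₀ i) (List.finRange m) y
  · -- over the box
    have hgΨ : g (Ψ x) = c₀ := by
      ext j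
      rw [hΨ']
      have h := apply_foldr_translating_coord hδΔ hθg (hδbox hx) hx (List.finRange m).reverse
        (List.nodup_reverse.2 (List.nodup_finRange m)) rfl j
      rw [if_pos (List.mem_reverse.2 (List.mem_finRange j))] at h
      exact h
    refine ⟨hgΨ, ?_⟩
    show (List.finRange m).foldr (fun i acc => θ i (g x i - c₀ i, acc))
      ((List.finRange m).foldl (fun acc i => θ i (-(g x i - c₀ i), acc)) x) = x
    exact Literature.Geometry.Manifold.foldr_foldl_flow h0 hadd (fun i => g x i - c₀ i) (List.finRange m) x
  · -- boundary behaviour of `Φ`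
    exact foldr_flow_mem_boundary_iff hθb (fun i => u i - c₀ i) (List.finRange m) y
  · -- boundary behaviour of `Ψ`
    rw [hΨ']
    exact foldr_flow_mem_boundary_iff hθb (fun i => c₀ i - g x i) (List.finRange m).reverse x

end Literature.Topology.FourManifolds

end
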